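import Summits.AtomisticToContinuum.Crystallization.Theorems.ReggeStarCoercivityStarCoercivityCoarseTierTransfer
import Summits.AtomisticToContinuum.Crystallization.Theorems.ChargedEnergyGap.Negative.Unconditional
import Literature.MathematicalPhysics.StatisticalMechanics.LennardJonesClusters

/-!
# Crux `GappedShellCensus.RadialDefectsVanish` (stmt-AtomisticToContinuum-15930), line `Sketch` (spine B):
# negative lemmas on the open core `stub_rdvTorusRigidity`

Kernel-checked findings of the crux disprover (cdisprove gen 2; dossier:
`Cruxes/RadialDefectsVanish/Disproof.lean` §5).  The stub (lead prover-line-…-15930-0; read back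
VERBATIM against the ledger signature by `stubTorusRigidity_iff`, `Iff.rfl`): ONE scale
`a ∈ [47/50, 1]` such that for all `δ, θ > 0` some `η > 0` makes every `δ`-separated periodic
configuration with `e(P) ≤ e* + η` have `≤ θ·#motif` radially bad motif points.

* `exists_sep_nearMin_periodic` — near-minimising `δ`-separated periodic configurations exist at ONE
  fixed `δ > 0`, for every `η > 0` (periodised ground states: `crysEnergyLimit`,
  `CoarseTierTransfer.exists_periodicConfiguration` / `energyPerParticle_le`, and the general-`δ`
  separation transfer `separated_points_of_le_two`).
* `not_torusRigidityAt_and`, `not_forall_torusRigidityAt` — the stub cannot hold at two exclusive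
  scales (`1.02a < 0.98a'`, `1.02a' < 1.26a`); in particular its `∃ a` cannot be strengthened to
  `∀ a ∈ [47/50, 1]`.
* `not_torusRigidityWithoutNearMinAt` — the near-minimality hypothesis `e(P) ≤ e* + η` is load-bearing
  (one point periodised with periods `≥ 2`: `2`-separated, all-bad at every `a ≤ 1`).
-/

noncomputable section

open scoped Classical
open Filter
open Literature.MathematicalPhysics.StatisticalMechanics
open Summit.AtomisticToContinuum.Crystallization.Theorems (CoarseTierTransfer.exists_periodicConfiguration
  CoarseTierTransfer.two_le_dist_of_mem_points CoarseTierTransfer.energyPerParticle_le)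
open Summit.AtomisticToContinuum.Crystallization.Theorems.ChargedEnergyGapNegative (eStar crysEnergyLimit)

namespace Summit.AtomisticToContinuum.Crystallization.Theorems.RadialDefectsVanish.Negative

local notation "E3" => EuclideanSpace ℝ (Fin 3)

/-! ## §5 Line `Sketch` (spine B, radial torus rigidity): the open core `stub_rdvTorusRigidity` -/

/-- Point `y` is gapped-twelve at scale `a` read in the (infinite) point set `S` — the inline clause of
the stub (and of `CleanLocalLimit` / `TornFree`).  An `abbrev`, so that `Finset.filter` finds the same
decidability instances as for the inline spelling. -/
abbrev IsGappedTwelveSet (a : ℝ) (S : Set E3) (y : E3) : Prop :=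
  {w ∈ S | w ≠ y ∧ dist y w ≤ a * (1 + 1 / 50)}.ncard = 12 ∧
    ∀ w ∈ S, w ≠ y → a * (1 - 1 / 50) ≤ dist y w ∧ (dist y w ≤ a * (1 + 1 / 50) ∨ a * (63 / 50) ≤ dist y w)

/-- The body of `stub_rdvTorusRigidity` at a given scale `a`. -/
def TorusRigidityAt (a : ℝ) : Prop :=
  ∀ δ : ℝ, 0 < δ → ∀ θ : ℝ, 0 < θ → ∃ η : ℝ, 0 < η ∧
    ∀ P : PeriodicConfiguration 3, (∀ u ∈ P.points, ∀ v ∈ P.points, u ≠ v → δ ≤ dist u v) →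
      P.energyPerParticle lennardJones ≤ eStar + η →
        ((P.motif.filter fun y => ¬ IsGappedTwelveSet a P.points y).card : ℝ) ≤ θ * P.motif.card

/-- `stub_rdvTorusRigidity` of the lead's skeleton (line `Sketch`, spine B = card
radial-torus-rigidity's `RadialTorusRigidity` with `eStar'` inlined). -/
def StubTorusRigidity : Prop :=
  ∃ a : ℝ, 47 / 50 ≤ a ∧ a ≤ 1 ∧ TorusRigidityAt a

/-- Read-back against the stub signature registered on the ledger (verbatim). -/
theorem stubTorusRigidity_iff : StubTorusRigidity ↔
    ∃ a : ℝ, 47 / 50 ≤ a ∧ a ≤ 1 ∧ ∀ δ : ℝ, 0 < δ → ∀ θ : ℝ, 0 < θ → ∃ η : ℝ, 0 < η ∧ ∀ P : PeriodicConfiguration 3, (∀ u ∈ P.points, ∀ v ∈ P.points, u ≠ v → δ ≤ dist u v) → P.energyPerParticle lennardJones ≤ (⨅ Q : PeriodicConfiguration 3, Q.energyPerParticle lennardJones) + η → ((P.motif.filter fun y => ¬ ({w ∈ P.points | w ≠ y ∧ dist y w ≤ a * (1 + 1 / 50)}.ncard = 12 ∧ ∀ w ∈ P.points, w ≠ y →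 a * (1 - 1 / 50) ≤ dist y w ∧ (dist y w ≤ a * (1 + 1 / 50) ∨ a * (63 / 50) ≤ dist y w))).card : ℝ) ≤ θ * P.motif.card :=
  Iff.rfl

/-- Scale exclusivity, set version. [folklore] -/
theorem not_isGappedTwelveSet_of_isGappedTwelveSet {a a' : ℝ}
    (h1 : a * (1 + 1 / 50) < a' * (1 - 1 / 50)) (h2 : a' * (1 + 1 / 50) < a * (63 / 50))
    {S : Set E3} {y : E3} (h : IsGappedTwelveSet a' S y) : ¬ IsGappedTwelveSet a S y := by
  rintro ⟨-, hfar⟩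
  obtain ⟨hcard, hfar'⟩ := h
  have hne : {w ∈ S | w ≠ y ∧ dist y w ≤ a' * (1 + 1 / 50)}.Nonempty :=
    Set.nonempty_of_ncard_ne_zero (by rw [hcard]; norm_num)
  obtain ⟨w, hwS, hwy, hd⟩ := hne
  obtain ⟨hlo, -⟩ := hfar' w hwS hwy
  obtain ⟨-, hor⟩ := hfar w hwS hwy
  rcases hor with h | h <;> linarith

/-- At two exclusive scales the bad motif counts add up to at least `#motif`. [folklore] -/
theorem card_motif_le_bad_add_bad {a a' : ℝ}
    (h1 : a * (1 + 1 / 50) < a' * (1 - 1 / 50)) (h2 : a' * (1 + 1 / 50) < a * (63 / 50))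
    (P : PeriodicConfiguration 3) :
    P.motif.card ≤ (P.motif.filter fun y => ¬ IsGappedTwelveSet a P.points y).card +
      (P.motif.filter fun y => ¬ IsGappedTwelveSet a' P.points y).card := by
  have key : ∀ y ∈ P.motif, ¬ IsGappedTwelveSet a P.points y ∨ ¬ IsGappedTwelveSet a' P.points y :=
    fun y _ => by
      by_cases h : IsGappedTwelveSet a' P.points y
      · exact Or.inl (not_isGappedTwelveSet_of_isGappedTwelveSet h1 h2 h)
      · exact Or.inr h
  calc P.motif.card = (P.motif.filter fun y =>
        ¬ IsGappedTwelveSet a P.points y ∨ ¬ IsGappedTwelveSet a' P.points y).card := by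
        rw [Finset.filter_true_of_mem key]
    _ ≤ _ := by rw [Finset.filter_or]; exact Finset.card_union_le _ _

/-- Separation transfers to the periodisation (general `δ ≤ 2`; the tree's
`CoarseTierTransfer.separated_points` is the case `δ = 1/3`). [folklore] -/
theorem separated_points_of_le_two {N : ℕ} {x : Fin N → E3} {P : PeriodicConfiguration 3}
    (hPm : P.motif = Finset.univ.image x)
    (hPl : ∀ g ∈ P.lattice, g ≠ 0 → 2 * ∑ k, ‖x k‖ + 2 ≤ ‖g‖) {δ : ℝ} (hδ2 : δ ≤ 2)
    (hsep : ∀ i j : Fin N, i ≠ j → δ ≤ dist (x i) (x j)) :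
    ∀ u ∈ P.points, ∀ v ∈ P.points, u ≠ v → δ ≤ dist u v := by
  rintro u ⟨z, hz, g, hg, rfl⟩ v hv huv
  rw [hPm] at hz
  obtain ⟨i, -, rfl⟩ := Finset.mem_image.1 hz
  have hv' : v - g ∈ P.points := by
    have h := P.add_mem_points hv (P.lattice.neg_mem hg)
    simpa [sub_eq_add_neg] using h
  have hdist : dist (x i + g) v = dist (x i) (v - g) := by
    rw [dist_eq_norm, dist_eq_norm]
    congr 1
    abel
  rw [hdist]
  by_cases h : ∃ j, v - g = x j
  · obtain ⟨j, hj⟩ := h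
    rw [hj]
    refine hsep i j ?_
    rintro rfl
    exact huv (sub_eq_iff_eq_add.1 hj).symm
  · push Not at h
    have h2 := CoarseTierTransfer.two_le_dist_of_mem_points hPm hPl i hv' h
    linarith

/-- **Near-minimising separated periodic configurations exist at a FIXED separation**: there is
`δ > 0` (the minimal distance of LJ ground states, capped at `2`) such that for every `η > 0` some
`δ`-separated periodic `P` has `e(P) ≤ e* + η` — periodise a ground state `x^N` with `E(N)/N ≤ e* + η`
(`crysEnergyLimit`, `LennardJonesGroundStatesExist_holds`, `LennardJonesMinimalDistance_holds`,
`CoarseTierTransfer.exists_periodicConfiguration` / `energyPerParticle_le`).  This is the input the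
skeleton's Bridge B feeds to the stub; here it powers the negative results below. [folklore] -/
theorem exists_sep_nearMin_periodic :
    ∃ δ : ℝ, 0 < δ ∧ ∀ η : ℝ, 0 < η → ∃ P : PeriodicConfiguration 3,
      (∀ u ∈ P.points, ∀ v ∈ P.points, u ≠ v → δ ≤ dist u v) ∧
        P.energyPerParticle lennardJones ≤ eStar + η := by
  obtain ⟨δ₀, hδ₀, hsep⟩ := LennardJonesMinimalDistance_holds
  refine ⟨min δ₀ 2, lt_min hδ₀ two_pos, fun η hη => ?_⟩
  have hlim := Summit.AtomisticToContinuum.Crystallization.Theorems.ChargedEnergyGapNegative.crysEnergyLimit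
  have hev : ∀ᶠ N : ℕ in atTop, groundStateEnergy lennardJones 3 N / N ∈ Set.Iio (eStar + η) :=
    hlim (Iio_mem_nhds (by unfold eStar; linarith))
  obtain ⟨N, hN, hN1⟩ := (hev.and (eventually_ge_atTop 1)).exists
  have hNpos : 0 < N := hN1
  obtain ⟨x, hx⟩ := LennardJonesGroundStatesExist_holds N
  obtain ⟨P, hPm, hPl⟩ := CoarseTierTransfer.exists_periodicConfiguration x hNpos
  refine ⟨P, separated_points_of_le_two hPm hPl (min_le_right _ _)
    fun i j hij => (min_le_left _ _).trans (hsep N x hx i j hij), ?_⟩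
  calc P.energyPerParticle lennardJones ≤ interactionEnergy lennardJones x / N :=
        CoarseTierTransfer.energyPerParticle_le hPm hPl hx.1 hNpos
    _ = groundStateEnergy lennardJones 3 N / N := by rw [hx.2]
    _ ≤ eStar + η := le_of_lt hN

/-- **Torus rigidity cannot hold at two exclusive scales** (e.g. `a = 47/50` and `a' = 1`): feed a
`δ`-separated near-minimiser within `min η η'` of `e*` to both instances with `θ = 1/3`; every motif
point is bad at one of the two scales, so `#motif ≤ (2/3)·#motif`, i.e. the motif is empty —
impossible. [folklore] -/
theorem not_torusRigidityAt_and {a a' : ℝ}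
    (h1 : a * (1 + 1 / 50) < a' * (1 - 1 / 50)) (h2 : a' * (1 + 1 / 50) < a * (63 / 50)) :
    ¬ (TorusRigidityAt a ∧ TorusRigidityAt a') := by
  rintro ⟨ha, ha'⟩
  obtain ⟨δ, hδ, hnear⟩ := exists_sep_nearMin_periodic
  obtain ⟨η, hη, hP⟩ := ha δ hδ (1 / 3) (by norm_num)
  obtain ⟨η', hη', hP'⟩ := ha' δ hδ (1 / 3) (by norm_num)
  obtain ⟨P, hsepP, heP⟩ := hnear (min η η') (lt_min hη hη')
  have hb := hP P hsepP (heP.trans (by linarith [min_le_left η η']))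
  have hb' := hP' P hsepP (heP.trans (by linarith [min_le_right η η']))
  have hc : (P.motif.card : ℝ) ≤ ((P.motif.filter fun y => ¬ IsGappedTwelveSet a P.points y).card : ℝ)
      + ((P.motif.filter fun y => ¬ IsGappedTwelveSet a' P.points y).card : ℝ) := by
    exact_mod_cast card_motif_le_bad_add_bad h1 h2 P
  have hpos : (1 : ℝ) ≤ P.motif.card := by exact_mod_cast Finset.card_pos.2 P.motif_nonempty
  linarith

/-- **The stub is FALSE with `∀ a ∈ [47/50, 1]` in place of `∃ a`**: its scale, too, must be
selected (the window's ends are exclusive). [folklore] -/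
theorem not_forall_torusRigidityAt :
    ¬ ∀ a : ℝ, 47 / 50 ≤ a → a ≤ 1 → TorusRigidityAt a := fun h =>
  not_torusRigidityAt_and (a := 47 / 50) (a' := 1) (by norm_num) (by norm_num)
    ⟨h _ le_rfl (by norm_num), h 1 (by norm_num) le_rfl⟩

/-- The stub with the near-minimality hypothesis `e(P) ≤ e* + η` DROPPED (at scale `a`). -/
def TorusRigidityWithoutNearMinAt (a : ℝ) : Prop :=
  ∀ δ : ℝ, 0 < δ → ∀ θ : ℝ, 0 < θ →
    ∀ P : PeriodicConfiguration 3, (∀ u ∈ P.points, ∀ v ∈ P.points, u ≠ v → δ ≤ dist u v) →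
      ((P.motif.filter fun y => ¬ IsGappedTwelveSet a P.points y).card : ℝ) ≤ θ * P.motif.card

/-- **Near-minimality is load-bearing in the stub**: without `e(P) ≤ e* + η` the statement fails at
every scale `a ≤ 1` — witness the Bravais lattice obtained by periodising ONE point with periods of
length `≥ 2` (`CoarseTierTransfer.exists_periodicConfiguration`): it is `2`-separated and its single
motif point has an empty `1.02a`-shell, so it is bad; `1 ≤ θ·1` fails for `θ = 1/2`. [folklore] -/
theorem not_torusRigidityWithoutNearMinAt {a : ℝ} (ha : a ≤ 1) : ¬ TorusRigidityWithoutNearMinAt a := by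
  intro h
  let x : Fin 1 → E3 := fun _ => 0
  obtain ⟨P, hPm, hPl⟩ := CoarseTierTransfer.exists_periodicConfiguration x one_pos
  have hsep : ∀ u ∈ P.points, ∀ v ∈ P.points, u ≠ v → (2 : ℝ) ≤ dist u v :=
    separated_points_of_le_two hPm hPl le_rfl fun i j hij => absurd (Subsingleton.elim i j) hij
  have hb := h 2 two_pos (1 / 2) (by norm_num) P hsep
  have hall : (P.motif.filter fun y => ¬ IsGappedTwelveSet a P.points y) = P.motif := by
    refine Finset.filter_true_of_mem fun y hy => ?_
    rintro ⟨hcard, -⟩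
    have hempty : {w ∈ P.points | w ≠ y ∧ dist y w ≤ a * (1 + 1 / 50)} = ∅ := by
      ext w
      simp only [Set.mem_setOf_eq, Set.mem_empty_iff_false, iff_false, not_and, not_le]
      intro hw hwy
      have h2 := hsep w hw y (P.mem_points_of_mem_motif hy) hwy
      rw [dist_comm] at h2
      nlinarith
    rw [hempty, Set.ncard_empty] at hcard
    norm_num at hcard
  rw [hall] at hb
  have hpos : (1 : ℝ) ≤ P.motif.card := by exact_mod_cast Finset.card_pos.2 P.motif_nonempty
  linarith


end Summit.AtomisticToContinuum.Crystallization.Theorems.RadialDefectsVanish.Negative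

end
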